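import Summits.ResolutionOfSingularities.ResolutionOfSingularities.Theorems.PurelyInseparableDim4ResConePowerChain
import HarnessLib

/-!
# Slice-B brick (K13): CONTACT-SUPPORT PERSISTENCE — the vertex form of a stretch never collapses onto the kept stretch-born letters

[OURS · counted 0 · linear-algebra bookkeeping]  Nothing here is a statement about resolution of singularities in
dimension ≥ 4 / characteristic `p`, which is NOT proved.  Cell `res-dim4-pi`, K2(p) lane, SLICE B (holder
res-dim4-p-12 g3, hand claim + signatures bus 2026-08-28T23:37:46Z; K11b (p-2 g3) and K12c (p-1 g3) consume it).

Along a constant-`(d, e_G = 3)` stretch the POWER-CONE PACKAGE `…ResConePowerChain.chain_powerCone_package` (p-2 g3)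
provides vertex forms `ℓ k`, units `λ k`, charts `j k` and chart points `b k` with, for `k ≥ k₀`:
(dir) `ℓ k (j k) + ℓ k ⬝ᵥ b k = 0` · (unit) `λ k ≠ 0` · (persist) `ℓ (k+1) i = λ k · ℓ k i` for `i ≠ j k` ·
(carry) some `i ≠ j k` has `ℓ k i ≠ 0`; and the witnesses have `b k (j k) = 0`.  From these ALONE (stated as
hypotheses, any index type, any field):

* `apply_chart_eq_zero_of_off` — if every letter `i ≠ j k` has `ℓ k i = 0` or `b k i = 0`, then (dir) forces
  `ℓ k (j k) = 0`;
* **`contactSupport_not_subset_single`** (K13a) — a STRETCH-BORN letter `e = j k₁` that is KEPT on `(k₁, k)` (no chart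
  equal to `e`, chart points with `b·e = 0`) never carries the whole form: `∃ m ≠ e, ℓ k m ≠ 0` (`k₁ < k`);
* **`contactSupport_not_subset_pair`** (K13b) — two stretch-born kept letters `e = j k₁ ≠ e′ = j k₂` (`k₁ < k₂ < k`)
  never carry the whole form: `∃ m ∉ {e, e′}, ℓ k m ≠ 0`.

So the (DL) residual «supp ℓ ⊆ {a, b}» of CARD I-4-7 is EMPTY for two stretch-born kept letters (holder's hand claim,
here in the kernel).  Typed and proved by res-dim4-typ-1 (g2) on call.  Supports stmt-ResolutionOfSingularities-16155
(helper).  bears_on: LADDER-RESOLUTION:D157-DOOR2 (res-dim4-pi · K2(p) slice B · K13).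
-/

set_option linter.dupNamespace false -- mandated namespace of this single-conjunct summit

namespace Summit.ResolutionOfSingularities.ResolutionOfSingularities.Theorems.PIDim4

namespace ResCone

open Finset

variable {ι : Type*} [Fintype ι] {K : Type*} [Field K]

/-- **The chart coefficient dies when nothing else meets the chart point**: from `ℓ (j) + ℓ ⬝ᵥ b = 0`, `b j = 0` and
«every `i ≠ j` has `ℓ i = 0` or `b i = 0`» follows `ℓ j = 0`. [folklore] -/
theorem apply_chart_eq_zero_of_off {ℓ b : ι → K} {j : ι} (hdir : ℓ j + dotProduct ℓ b = 0) (hbj : b j = 0)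
    (hoff : ∀ i, i ≠ j → ℓ i = 0 ∨ b i = 0) : ℓ j = 0 := by
  have hsum : dotProduct ℓ b = 0 := by
    unfold dotProduct
    refine Finset.sum_eq_zero fun i _ => ?_
    by_cases hij : i = j
    · rw [hij, hbj, mul_zero]
    · rcases hoff i hij with h | h
      · rw [h, zero_mul]
      · rw [h, mul_zero]
  rwa [hsum, add_zero] at hdir

section Stretch

variable {ℓ : ℕ → ι → K} {lam : ℕ → K} {j : ℕ → ι} {b : ℕ → ι → K} {k₀ : ℕ}

/-- **(K13a) ONE KEPT STRETCH-BORN LETTER NEVER CARRIES THE WHOLE FORM.**  For `e = j k₁` (`k₀ ≤ k₁ < k`) kept on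
`(k₁, k)`: `∃ m ≠ e, ℓ k m ≠ 0`. [OURS · res-dim4-p-12 g3 hand claim] -/
theorem contactSupport_not_subset_single
    (hdir : ∀ k, k₀ ≤ k → ℓ k (j k) + dotProduct (ℓ k) (b k) = 0)
    (hlam : ∀ k, k₀ ≤ k → lam k ≠ 0)
    (hprop : ∀ k, k₀ ≤ k → ∀ i, i ≠ j k → ℓ (k + 1) i = lam k * ℓ k i)
    (hcarry : ∀ k, k₀ ≤ k → ∃ i, i ≠ j k ∧ ℓ k i ≠ 0)
    (hbj : ∀ k, b k (j k) = 0)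
    {k₁ k : ℕ} (hk₁ : k₀ ≤ k₁) (hk : k₁ < k)
    (hkept : ∀ k'', k₁ < k'' → k'' < k → j k'' ≠ j k₁ ∧ b k'' (j k₁) = 0) :
    ∃ m, m ≠ j k₁ ∧ ℓ k m ≠ 0 := by
  induction k, hk using Nat.le_induction with
  | base =>
    -- the letter carrying `ℓ k₁` off the chart persists
    obtain ⟨i, hij, hi⟩ := hcarry k₁ hk₁
    refine ⟨i, hij, ?_⟩
    rw [hprop k₁ hk₁ i hij]
    exact mul_ne_zero (hlam k₁ hk₁) hi
  | succ k hk ih =>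
    have hk₀k : k₀ ≤ k := by omega
    obtain ⟨hjk, hbke⟩ := hkept k hk (Nat.lt_succ_self k)
    obtain ⟨m, hme, hm⟩ := ih fun k'' h1 h2 => hkept k'' h1 (Nat.lt_succ_of_lt h2)
    -- some letter off `{j k, e}` carries `ℓ k` — else the chart coefficient dies and `supp ℓ k ⊆ {e}`
    obtain ⟨i, hij, hie, hi⟩ : ∃ i, i ≠ j k ∧ i ≠ j k₁ ∧ ℓ k i ≠ 0 := by
      by_contra hno
      push Not at hno
      have hchart : ℓ k (j k) = 0 :=
        apply_chart_eq_zero_of_off (hdir k hk₀k) (hbj k) fun i hij => by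
          by_cases hie : i = j k₁
          · exact Or.inr (by rw [hie]; exact hbke)
          · exact Or.inl (hno i hij hie)
      by_cases hmj : m = j k
      · exact hm (by rw [hmj]; exact hchart)
      · exact hm (hno m hmj hme)
    refine ⟨i, hie, ?_⟩
    rw [hprop k hk₀k i hij]
    exact mul_ne_zero (hlam k hk₀k) hi

/-- **(K13b) TWO KEPT STRETCH-BORN LETTERS NEVER CARRY THE WHOLE FORM.**  For `e = j k₁ ≠ e′ = j k₂`
(`k₀ ≤ k₁ < k₂ < k`), both kept up to `k`: `∃ m ∉ {e, e′}, ℓ k m ≠ 0` — the (DL) residual «`supp ℓ ⊆ {e, e′}`» is empty.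
(`e ≠ e′` is implied by `hkept₁` at `k₂` and therefore not a hypothesis.)
[OURS · res-dim4-p-12 g3 hand claim] -/
theorem contactSupport_not_subset_pair
    (hdir : ∀ k, k₀ ≤ k → ℓ k (j k) + dotProduct (ℓ k) (b k) = 0)
    (hlam : ∀ k, k₀ ≤ k → lam k ≠ 0)
    (hprop : ∀ k, k₀ ≤ k → ∀ i, i ≠ j k → ℓ (k + 1) i = lam k * ℓ k i)
    (hcarry : ∀ k, k₀ ≤ k → ∃ i, i ≠ j k ∧ ℓ k i ≠ 0)
    (hbj : ∀ k, b k (j k) = 0)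
    {k₁ k₂ k : ℕ} (hk₁ : k₀ ≤ k₁) (h12 : k₁ < k₂) (h2k : k₂ < k)
    (hkept₁ : ∀ k'', k₁ < k'' → k'' < k → j k'' ≠ j k₁ ∧ b k'' (j k₁) = 0)
    (hkept₂ : ∀ k'', k₂ < k'' → k'' < k → j k'' ≠ j k₂ ∧ b k'' (j k₂) = 0) :
    ∃ m, m ≠ j k₁ ∧ m ≠ j k₂ ∧ ℓ k m ≠ 0 := by
  induction k, h2k using Nat.le_induction with
  | base =>
    -- at the birth step of `e′`: `e` is kept there, and `ℓ k₂` does not live on `{e}`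
    have hk₀₂ : k₀ ≤ k₂ := by omega
    obtain ⟨-, hb2e⟩ := hkept₁ k₂ h12 (Nat.lt_succ_self k₂)
    obtain ⟨m, hme, hm⟩ := contactSupport_not_subset_single hdir hlam hprop hcarry hbj hk₁ h12
      fun k'' h1 h2 => hkept₁ k'' h1 (Nat.lt_succ_of_lt h2)
    obtain ⟨i, hij, hie, hi⟩ : ∃ i, i ≠ j k₂ ∧ i ≠ j k₁ ∧ ℓ k₂ i ≠ 0 := by
      by_contra hno
      push Not at hno
      have hchart : ℓ k₂ (j k₂) = 0 :=
        apply_chart_eq_zero_of_off (hdir k₂ hk₀₂) (hbj k₂) fun i hij => by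
          by_cases hie : i = j k₁
          · exact Or.inr (by rw [hie]; exact hb2e)
          · exact Or.inl (hno i hij hie)
      by_cases hmj : m = j k₂
      · exact hm (by rw [hmj]; exact hchart)
      · exact hm (hno m hmj hme)
    refine ⟨i, hie, hij, ?_⟩
    rw [hprop k₂ hk₀₂ i hij]
    exact mul_ne_zero (hlam k₂ hk₀₂) hi
  | succ k hk ih =>
    have hk₀k : k₀ ≤ k := by omega
    obtain ⟨hjk₁, hbke⟩ := hkept₁ k (by omega) (Nat.lt_succ_self k)
    obtain ⟨hjk₂, hbke'⟩ := hkept₂ k hk (Nat.lt_succ_self k)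
    obtain ⟨m, hme, hme', hm⟩ := ih (fun k'' h1 h2 => hkept₁ k'' h1 (Nat.lt_succ_of_lt h2))
      (fun k'' h1 h2 => hkept₂ k'' h1 (Nat.lt_succ_of_lt h2))
    -- some letter off `{j k, e, e′}` carries `ℓ k` — else the chart coefficient dies and `supp ℓ k ⊆ {e, e′}`
    obtain ⟨i, hij, hie, hie', hi⟩ : ∃ i, i ≠ j k ∧ i ≠ j k₁ ∧ i ≠ j k₂ ∧ ℓ k i ≠ 0 := by
      by_contra hno
      push Not at hno
      have hchart : ℓ k (j k) = 0 :=
        apply_chart_eq_zero_of_off (hdir k hk₀k) (hbj k) fun i hij => by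
          by_cases hie : i = j k₁
          · exact Or.inr (by rw [hie]; exact hbke)
          · by_cases hie' : i = j k₂
            · exact Or.inr (by rw [hie']; exact hbke')
            · exact Or.inl (hno i hij hie hie')
      by_cases hmj : m = j k
      · exact hm (by rw [hmj]; exact hchart)
      · exact hm (hno m hmj hme hme')
    refine ⟨i, hie, hie', ?_⟩
    rw [hprop k hk₀k i hij]
    exact mul_ne_zero (hlam k hk₀k) hi

end Stretch

end ResCone

end Summit.ResolutionOfSingularities.ResolutionOfSingularities.Theorems.PIDim4
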